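import Summits.Ventures.Crystal3D.Theorems.StickyWulffConstantGenericWallFloorStackLedgerOneSidedDownDirs
import Summits.Ventures.Crystal3D.Theorems.StickyWulffConstantGenericWallFloorAtHalfWideDown
import Summits.Ventures.Crystal3D.Theorems.StickyWulffConstantGenericWallFloorStackPushForm
import HarnessLib

/-!
# One-sided floors FROM ABOVE for ANY steering vertical under the weak direction ceiling `hdirs`: the `TwoSlabLedgerAt` /
# `GenericWallFloorAtCharge` packaging of `…StackLedgerOneSidedDownDirs` (crux `GenericWallFloor`, stmt-Ventures-19480, line `WallLedgerG`)

HONEST FRAMING. Venture `Summits/Ventures/Crystal3D` (cell `crystal3d-full`), helper `--supports` the crux `GenericWallFloor`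
of `route-Ventures-StickyWulffConstant`, REGISTERED line `WallLedgerG`, open stub `stub_twoSlabAdhesion`.  Rung credit only;
F-C1 not moved; NOT the crux (charges `< 1`; inputs `ExactOnly`(C12-55) [E1], `StarPairFar` BY NAME, and the W1 hypothesis
`hdirs` for the top grain's family — NOT discharged here).

Mirror of `…AtDirs` (19480-p2 g8) for grain 2: packages `twoSlabAdhesion_stackLedger_oneSidedDown_dirs` as
* `twoSlabLedgerAt_oneSidedDown_dirs` — `TwoSlabLedgerAt (√2|⟪A₂u₂,e₃⟫|/2) A₁ t₁ A₂ t₂`, modulo `ExactOnly`(C12-55) and `StarPairFar`;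
* `genericWallFloorAtCharge_oneSidedDown_dirs_of_far` / `genericWallFloorAtCharge_oneSidedDown_dirs` (canonical frame set, charge
  `√2·(−(A₂u₂)₂)/2`) / `genericWallFloorAtCharge_wordDown_dirs` (word floor from grain 2, any steering);
* `hdirsDown_of_forall_mem_inner` — 19480-p1 g9's ∀-entry form with the inward vertical `w = −e₃`
  (`δ ≤ ⟪e.frame e.dir, −e₃⟫`, `0 ≤ δ`) implies the ceiling form of `hdirs` as typed.
WHAT THIS IS NOT: not `c₀ = 1`; `hdirs` not discharged (19480-p1 g9); F-C1 not moved.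
-/

noncomputable section

namespace Summit.Ventures.Crystal3D.Theorems

open Summit.Ventures.Crystal3D Finset
open Literature.MathematicalPhysics.StatisticalMechanics (fccStacking barlowStacking IsHaggSeq)
open scoped InnerProductSpace

/-- **19480-p1's ∀-entry form with the inward vertical `−e₃` implies the ceiling form of `hdirs`.** -/
theorem hdirsDown_of_forall_mem_inner {z : EuclideanSpace ℝ (Fin 3)} {b : WalkEntry} {δ : ℝ} (hδ : 0 ≤ δ)
    (h : ∀ stk : List WalkEntry, StackSound z stk → StackWF z stk → stk.getLast? = some b →
      ∀ e ∈ stk, δ ≤ ⟪e.frame e.dir, -EuclideanSpace.single (2 : Fin 3) (1 : ℝ)⟫_ℝ) :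
    ∀ stk : List WalkEntry, StackSound z stk → StackWF z stk → stk.getLast? = some b →
      ∀ e rest, stk = e :: rest → (e.frame e.dir) 2 ≤ 0 := by
  intro stk hS hW hlast e rest hstk
  have h1 := h stk hS hW hlast e (by rw [hstk]; simp)
  rw [inner_neg_right, EuclideanSpace.inner_single_right] at h1
  simp only [conj_trivial, one_mul] at h1
  linarith

open scoped Classical in
/-- **`TwoSlabLedgerAt` from grain 2 alone, any steering, weak direction ceiling**, modulo `ExactOnly`(C12-55) and `StarPairFar`. -/
theorem twoSlabLedgerAt_oneSidedDown_dirs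
    {s₀ : EuclideanSpace ℝ (Fin 3)} (hs₀ : s₀ ∈ fccSlots)
    (hcert : ExactOnly 0 (fccSlots.filter fun w => 0 < ⟪w, s₀⟫_ℝ)) (hSP : StarPairFar)
    (A₁ : EuclideanSpace ℝ (Fin 3) ≃ₗᵢ[ℝ] EuclideanSpace ℝ (Fin 3)) (t₁ : EuclideanSpace ℝ (Fin 3))
    (A₂ : EuclideanSpace ℝ (Fin 3) ≃ₗᵢ[ℝ] EuclideanSpace ℝ (Fin 3)) (t₂ : EuclideanSpace ℝ (Fin 3))
    {z : EuclideanSpace ℝ (Fin 3)} (hz : ‖z‖ = 1)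
    {u₂ : EuclideanSpace ℝ (Fin 3)} (hu₂ : u₂ ∈ fccSlots) (hsteep₂ : Real.sqrt 2 / 2 ≤ ⟪A₂ u₂, z⟫_ℝ)
    {δ : ℝ} (hδ : 0 < δ) (hdown : δ ≤ -(A₂ u₂) 2)
    (M₂ : Set (EuclideanSpace ℝ (Fin 3) ≃ₗᵢ[ℝ] EuclideanSpace ℝ (Fin 3)))
    (hM₂ : ∀ stk : List WalkEntry, StackSound z stk → StackWF z stk → stk.getLast? = some ⟨A₂, u₂, 0⟩ →
      ∀ e ∈ stk, e.frame ∈ M₂)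
    (hmiss : ∀ F ∈ M₂, F '' fccStacking 1 (Real.sqrt (2 / 3)) ≠ A₁ '' fccStacking 1 (Real.sqrt (2 / 3)))
    (hdirs : ∀ stk : List WalkEntry, StackSound z stk → StackWF z stk → stk.getLast? = some ⟨A₂, u₂, 0⟩ →
      ∀ e rest, stk = e :: rest → (e.frame e.dir) 2 ≤ 0) :
    TwoSlabLedgerAt (Real.sqrt 2 * |⟪A₂ u₂, EuclideanSpace.single (2 : Fin 3) (1 : ℝ)⟫_ℝ| / 2) A₁ t₁ A₂ t₂ :=
  twoSlabAdhesion_stackLedger_oneSidedDown_dirs hs₀ hcert (doubleStarCoaxialAt_of_starPairFar hSP)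
    (capPairCoaxial_of_starPairFar hSP) A₁ t₁ A₂ t₂ hz hu₂ hsteep₂ hδ hdown M₂ hM₂ hmiss hdirs

open scoped Classical in
/-- **Charge `½κ₂` from grain 2 alone, any steering, weak direction ceiling** (abstract frame set `M₂`), modulo
`ExactOnly`(C12-55) and `StarPairFar`. -/
theorem genericWallFloorAtCharge_oneSidedDown_dirs_of_far
    {s₀ : EuclideanSpace ℝ (Fin 3)} (hs₀ : s₀ ∈ fccSlots)
    (hcert : ExactOnly 0 (fccSlots.filter fun w => 0 < ⟪w, s₀⟫_ℝ)) (hSP : StarPairFar)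
    (A₁ : EuclideanSpace ℝ (Fin 3) ≃ₗᵢ[ℝ] EuclideanSpace ℝ (Fin 3)) (t₁ : EuclideanSpace ℝ (Fin 3))
    (A₂ : EuclideanSpace ℝ (Fin 3) ≃ₗᵢ[ℝ] EuclideanSpace ℝ (Fin 3)) (t₂ : EuclideanSpace ℝ (Fin 3))
    {z : EuclideanSpace ℝ (Fin 3)} (hz : ‖z‖ = 1)
    {u₂ : EuclideanSpace ℝ (Fin 3)} (hu₂ : u₂ ∈ fccSlots) (hsteep₂ : Real.sqrt 2 / 2 ≤ ⟪A₂ u₂, z⟫_ℝ)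
    {δ : ℝ} (hδ : 0 < δ) (hdown : δ ≤ -(A₂ u₂) 2)
    (M₂ : Set (EuclideanSpace ℝ (Fin 3) ≃ₗᵢ[ℝ] EuclideanSpace ℝ (Fin 3)))
    (hM₂ : ∀ stk : List WalkEntry, StackSound z stk → StackWF z stk → stk.getLast? = some ⟨A₂, u₂, 0⟩ →
      ∀ e ∈ stk, e.frame ∈ M₂)
    (hmiss : ∀ F ∈ M₂, F '' fccStacking 1 (Real.sqrt (2 / 3)) ≠ A₁ '' fccStacking 1 (Real.sqrt (2 / 3)))
    (hdirs : ∀ stk : List WalkEntry, StackSound z stk → StackWF z stk → stk.getLast? = some ⟨A₂, u₂, 0⟩ →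
      ∀ e rest, stk = e :: rest → (e.frame e.dir) 2 ≤ 0) :
    GenericWallFloorAtCharge (Real.sqrt 2 * |⟪A₂ u₂, EuclideanSpace.single (2 : Fin 3) (1 : ℝ)⟫_ℝ| / 2) A₁ t₁ A₂ t₂ :=
  genericWallFloorAtCharge_of_ledger _ A₁ t₁ A₂ t₂
    (twoSlabLedgerAt_oneSidedDown_dirs hs₀ hcert hSP A₁ t₁ A₂ t₂ hz hu₂ hsteep₂ hδ hdown M₂ hM₂ hmiss hdirs)

open scoped Classical in
/-- **Charge `½κ₂ = (√2/2)·(−(A₂u₂)₂)` from grain 2 alone, any steering, weak direction ceiling, CANONICAL frame set**: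
the lattice-separation hypothesis is stated directly on the frames of sound well-formed `z`-stacks over `⟨A₂, u₂, 0⟩`; modulo
`ExactOnly`(C12-55) and `StarPairFar`. -/
theorem genericWallFloorAtCharge_oneSidedDown_dirs
    {s₀ : EuclideanSpace ℝ (Fin 3)} (hs₀ : s₀ ∈ fccSlots)
    (hcert : ExactOnly 0 (fccSlots.filter fun w => 0 < ⟪w, s₀⟫_ℝ)) (hSP : StarPairFar)
    (A₁ : EuclideanSpace ℝ (Fin 3) ≃ₗᵢ[ℝ] EuclideanSpace ℝ (Fin 3)) (t₁ : EuclideanSpace ℝ (Fin 3))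
    (A₂ : EuclideanSpace ℝ (Fin 3) ≃ₗᵢ[ℝ] EuclideanSpace ℝ (Fin 3)) (t₂ : EuclideanSpace ℝ (Fin 3))
    {z : EuclideanSpace ℝ (Fin 3)} (hz : ‖z‖ = 1)
    {u₂ : EuclideanSpace ℝ (Fin 3)} (hu₂ : u₂ ∈ fccSlots) (hsteep₂ : Real.sqrt 2 / 2 ≤ ⟪A₂ u₂, z⟫_ℝ)
    {δ : ℝ} (hδ : 0 < δ) (hdown : δ ≤ -(A₂ u₂) 2)
    (hmiss : ∀ stk : List WalkEntry, StackSound z stk → StackWF z stk → stk.getLast? = some ⟨A₂, u₂, 0⟩ →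
      ∀ e ∈ stk, e.frame '' fccStacking 1 (Real.sqrt (2 / 3)) ≠ A₁ '' fccStacking 1 (Real.sqrt (2 / 3)))
    (hdirs : ∀ stk : List WalkEntry, StackSound z stk → StackWF z stk → stk.getLast? = some ⟨A₂, u₂, 0⟩ →
      ∀ e rest, stk = e :: rest → (e.frame e.dir) 2 ≤ 0) :
    GenericWallFloorAtCharge (Real.sqrt 2 * (-(A₂ u₂) 2) / 2) A₁ t₁ A₂ t₂ := by
  have he₃i : ⟪A₂ u₂, EuclideanSpace.single (2 : Fin 3) (1 : ℝ)⟫_ℝ = (A₂ u₂) 2 := by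
    rw [EuclideanSpace.inner_single_right]; simp
  have habs : |⟪A₂ u₂, EuclideanSpace.single (2 : Fin 3) (1 : ℝ)⟫_ℝ| = -(A₂ u₂) 2 := by
    rw [he₃i]; exact abs_of_nonpos (by linarith)
  have h := genericWallFloorAtCharge_oneSidedDown_dirs_of_far hs₀ hcert hSP A₁ t₁ A₂ t₂ hz hu₂ hsteep₂ hδ hdown
    {F | ∃ stk : List WalkEntry, StackSound z stk ∧ StackWF z stk ∧ stk.getLast? = some ⟨A₂, u₂, 0⟩ ∧
      ∃ e ∈ stk, e.frame = F}
    (fun stk hS hW hlast e he => ⟨stk, hS, hW, hlast, e, he, rfl⟩)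
    (fun _ ⟨stk, hS, hW, hl, e, he, hF⟩ => by rw [← hF]; exact hmiss stk hS hW hl e he) hdirs
  rw [habs] at h
  exact h

open scoped Classical in
/-- **Word floor from grain 2, any steering**: chain pair `A₁·Λ₀ = (wordFrame A₂ κ)·Λ₀` with `|κ| ≥ 2`, down-slot `u₂` IN
grain 2's first mirror plane, steep for SOME unit steering `z` and dropping in true height by `δ > 0`, whose walker family
satisfies the ceiling form of `hdirs`: `GenericWallFloorAtCharge ((√2/2)·(−(A₂u₂)₂))`, modulo `ExactOnly`(C12-55) and
`StarPairFar`. -/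
theorem genericWallFloorAtCharge_wordDown_dirs
    {s₀ : EuclideanSpace ℝ (Fin 3)} (hs₀ : s₀ ∈ fccSlots)
    (hcert : ExactOnly 0 (fccSlots.filter fun w => 0 < ⟪w, s₀⟫_ℝ)) (hSP : StarPairFar)
    (A₁ : EuclideanSpace ℝ (Fin 3) ≃ₗᵢ[ℝ] EuclideanSpace ℝ (Fin 3)) (t₁ : EuclideanSpace ℝ (Fin 3))
    (A₂ : EuclideanSpace ℝ (Fin 3) ≃ₗᵢ[ℝ] EuclideanSpace ℝ (Fin 3)) (t₂ : EuclideanSpace ℝ (Fin 3))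
    {z : EuclideanSpace ℝ (Fin 3)} (hz : ‖z‖ = 1)
    {u₂ : EuclideanSpace ℝ (Fin 3)} (hu₂ : u₂ ∈ fccSlots) (hsteep₂ : Real.sqrt 2 / 2 ≤ ⟪A₂ u₂, z⟫_ℝ)
    {δ : ℝ} (hδ : 0 < δ) (hdown : δ ≤ -(A₂ u₂) 2)
    (κ : List (EuclideanSpace ℝ (Fin 3)))
    (hκl : ∀ μ ∈ κ, ‖μ‖ = 1 ∧
      ∀ w ∈ fccSlots, ⟪w, μ⟫_ℝ = 0 ∨ ⟪w, μ⟫_ℝ = Real.sqrt (2 / 3) ∨ ⟪w, μ⟫_ℝ = -Real.sqrt (2 / 3))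
    (hκc : List.IsChain (fun μ μ' => ⟪μ, μ'⟫_ℝ = 1 / 3 ∨ ⟪μ, μ'⟫_ℝ = -1 / 3) κ) (hκ2 : 2 ≤ κ.length)
    (hA₁ : A₁ '' fccStacking 1 (Real.sqrt (2 / 3)) = (wordFrame A₂ κ) '' fccStacking 1 (Real.sqrt (2 / 3)))
    (hfirst : ∀ μ, κ.getLast? = some μ → ⟪u₂, μ⟫_ℝ = 0)
    (hdirs : ∀ stk : List WalkEntry, StackSound z stk → StackWF z stk → stk.getLast? = some ⟨A₂, u₂, 0⟩ →
      ∀ e rest, stk = e :: rest → (e.frame e.dir) 2 ≤ 0) :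
    GenericWallFloorAtCharge (Real.sqrt 2 * (-(A₂ u₂) 2) / 2) A₁ t₁ A₂ t₂ :=
  genericWallFloorAtCharge_oneSidedDown_dirs hs₀ hcert hSP A₁ t₁ A₂ t₂ hz hu₂ hsteep₂ hδ hdown
    (fun _ hS hW hl _ he => image_ne_of_word κ hκl hκc hκ2 hA₁ hfirst hS hW hl he) hdirs

end Summit.Ventures.Crystal3D.Theorems

end
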